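import Mathlib.FieldTheory.AlgebraicClosure
import Mathlib.Analysis.Complex.Polynomial.Basic
import Mathlib.RingTheory.Valuation.ValuationSubring
import Literature.AlgebraicGeometry.Resolution.GeneralizedStabilityFiniteRankLemmas
import Literature.AlgebraicGeometry.Motives.PeriodComparison
import Literature.AlgebraicGeometry.Motives.EtaleRealization
import Literature.AlgebraicGeometry.Motives.CrystallineRealization
import Literature.AlgebraicGeometry.Motives.GoodReduction
import Literature.AlgebraicGeometry.Motives.AbelianVariety
import Literature.AlgebraicGeometry.HodgeTheory.RationalHodgeClasses
import Literature.AlgebraicGeometry.HodgeTheory.RationalLattice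
import HarnessLib

/-!
# Milne's rationality conjecture (Milne, *Rational Tate classes*, Mosc. Math. J. 9 (2009), §4.1)

Family `hodge`, topic `Literature/AlgebraicGeometry/Motives`. Requested by route
`HodgeConjecture/LosTransfer` (crux `MilneRationality`, definition request P2).

**The conjecture, verbatim** (Milne 2009, §4.1, p. 18 of the held text `arXiv:0707.3167`; `ℚ^al` is
the algebraic closure of `ℚ` in `ℂ`, `w` a fixed `p`-adic prime of `ℚ^al` with residue field `𝔽`,
an algebraic closure of `𝔽_p`, §3.1 p. 13):

> **Rationality Conjecture.** Let `A` be an abelian variety over `ℚ^al` with good reduction to an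
> abelian variety `A₀` over `𝔽`. The cup product of the specialization to `A₀` of any Hodge class on
> `A` with any Lefschetz class of complementary dimension lies in `ℚ`.
> In more detail, a Hodge class on `A` is an element `γ` of `H^{2*}_𝔸(A)(*)` and its specialization
> `γ₀` is an element of `H^{2*}_𝔸(A₀)(*)`. Thus the cup product `γ₀ ∪ δ` of `γ₀` with a Lefschetz
> class of complementary dimension `δ` lies in `H^{2d}_𝔸(A₀)(d) ≃ 𝔸^p_f × ℚ^al_w`, `d = dim A`. The
> conjecture says that it lies in `ℚ ⊂ 𝔸^p_f × ℚ^al_w`. Equivalently, it says that the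
> `l`-component of `γ₀ ∪ δ` is a rational number independent of `l`.

Here (Conventions, p. 2) "`l` is allowed to equal `p`":
`H_𝔸(A) = (lim_m H(A_ét, ℤ/m) ⊗ ℚ) × H_dR(A)`,
`H_𝔸(A₀) = (lim_{p∤m} H(A₀,ét, ℤ/m) ⊗ ℚ) × H_p(A₀) ⊗_{B(𝔽)} ℚ^al_w` (`H_p` = crystalline
cohomology, `B(𝔽) = W(𝔽)[1/p]`), and the specialization map is the smooth-proper base change
isomorphism `H(A_ét, ℤ/m) ≃ H(A₀,ét, ℤ/m)` (`p ∤ m`) times the comparison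
`H_dR(A) ⊗ ℚ^al_w ≃ H_p(A₀) ⊗_{B(𝔽)} ℚ^al_w` (§3.1, p. 13). "Hodge classes" on `A` are the absolute
Hodge classes `𝓑^*(A) ⊂ H^{2*}_𝔸(A)(*)`, which for abelian varieties are the Hodge classes of `A_ℂ`
(Deligne 1982, Thm. 2.11; Milne §3.1: "Because of Deligne's theorem I refer to the absolute Hodge
classes … simply as Hodge classes"); a **Lefschetz class** is an element of the `ℚ`-subalgebra of
`H^{2*}(A₀)(*)` generated by the divisor classes (§1.3, p. 7), i.e. a `ℚ`-linear combination of
the monomials `cl(D₁) ∪ ⋯ ∪ cl(D_s)` in classes of prime divisors `Dᵢ` of `A₀`.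
Context (§4.1): implied by the Hodge conjecture for abelian varieties (true whenever `γ₀` is
algebraic); known for `A` CM with `A₀` simple ordinary (Ex. 4.1); Thm. 4.3 and Aside 4.6 relate the
CM case to good theories of rational Tate classes and to the general case.

## Lean rendering

ℓ-adic and crystalline cohomology, their cycle classes and the base-change / comparison
isomorphisms are not constructed in Mathlib or in the tree; as in `TateConjecture`,
`DeligneAbsoluteHodgeStatement`, `HodgeClassesArePotentiallyTate`, `CrystallineRealization` they
enter as HYPOTHESIS STRUCTURES, bundled in `MilneRealizationData k p O` (the explicit binder of the
conjecture), with the conventions of the sibling `HodgeClassesArePotentiallyTate` of the same route: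
* `ℚ^al ⊂ ℂ` is the subfield `(algebraicClosure ℚ ℂ).toSubfield` (as in `HodgeTheory/HodgeLocus`),
  `ι` its inclusion; the prime `w` is `O : ValuationSubring ℚ^al` with residue field
  `𝔽 = IsLocalRing.ResidueField O` of characteristic `p` (instance argument `[CharP 𝔽 p]`; so
  `O ≠ ℚ^al`, `𝔽` is an algebraic closure of `𝔽_p`, and every `p`-adic prime `w` is such an `O`);
* "`A` with good reduction to `A₀`": `A : AbelianVariety ℚ^al` with a smooth proper model
  `𝒜 : IntegralModel O ℚ^al A.X`, `𝒜.IsSmoothProper A.dim` (tree `GoodReduction`, Serre–Tate 1968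
  §1), `A₀ := 𝒜.specialFibre` (then automatically an abelian variety over `𝔽`, loc. cit.);
* `D.E ℓ : EtaleRealization ℚ^al ℓ`, `D.artin ℓ : ArtinComparison (D.E ℓ) D.P.B ι` (ℓ-adic
  cohomology of `ℚ^al`-varieties, Artin's comparison), where `D.P : PeriodRealization ℚ^al` supplies
  algebraic de Rham cohomology `D.P.dR`, Betti–Hodge data `D.P.B` (identified with REAL rational
  singular cohomology of the complex points by `D.P.B.isoObj`) and Grothendieck's comparison
  `D.P.iso ι` (twisted by `(2πi)^r` on codimension-`r` cycle classes);
* `D.E₀ ℓ hℓ : EtaleRealization 𝔽 ℓ` (`ℓ ≠ p`) and `D.crys : CrystallineRealization p 𝔽` (the tree's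
  crystalline interface, coefficients `B(𝔽) = K(p, 𝔽)`), and a field `D.L` over `ℚ^al` and `B(𝔽)`
  (intended: `ℚ^al_w`) in which `H_p(A₀) ⊗_{B(𝔽)} ℚ^al_w` is formed;
* the specialization maps: NEW hypothesis structure `SpecializationData R W W₀ L` — for every model
  `𝒳` over the local ring `R` of `X`, maps `L ⊗ H(X) ⇄ L ⊗ H₀(𝒳.specialFibre)`, mutually inverse
  and compatible with units, cup products and traces when `X` is smooth projective and `𝒳` smooth
  proper (intended: cospecialisation, SGA 4½ [Arcata] V Thm. 3.1, for `D.sp ℓ hℓ`; Berthelot–Ogus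
  1983 Thm. 2.4 — over ANY complete d.v.r., also ramified, unlike `CrystallineRealization.bo`,
  which is over `W(𝔽)` — for `D.spCrys`);
* "Hodge class `γ` on `A`": as in `HodgeClassesArePotentiallyTate`, a rational Betti class
  `t ∈ D.P.B.W.obj (A ⊗_ι ℂ) (2r) ≃ H^{2r}(A(ℂ); ℚ)` with cocycle witness `ζ` (`[ζ] = isoObj t`)
  whose complexification `[ζ ⊗ 1]` is of Hodge type `(r, r)` in the REAL sense of the summit
  statement (`HodgeTheory.IsOfHodgeType`); its `ℓ`-component is its image under `D.artin ℓ`, its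
  de Rham component any `α ∈ H^{2r}_dR(A/ℚ^al)` with `iso_ι (1 ⊗ α) = (2πi)^r (1 ⊗ t)`, quantified
  universally (existence of `α` — descent of the de Rham component to `ℚ^al` — is Deligne 1982,
  Prop. 2.9 / Thm. 2.11, not presupposed; at the intended data it exists uniquely, so the clause is
  exactly Milne's `p`-component);
* "Lefschetz class of complementary dimension": the monomials `divisorMonomial A₀ s D`,
  `D : Fin s → A₀` prime divisors, `r + s = dim A`. Milne's Lefschetz classes are the `ℚ`-linear
  combinations `δ = Σ qⱼ mⱼ` of monomials, with the SAME `qⱼ` in every component of `H_𝔸(A₀)`; as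
  `⟨γ₀ ∪ δ⟩_l = Σ qⱼ ⟨γ₀ ∪ mⱼ⟩_l`, "rational and independent of `l`" for all Lefschetz `δ` is
  equivalent to the same for all monomials, which is what is written;
* "lies in `ℚ ⊂ 𝔸^p_f × ℚ^al_w`" = `∃ q : ℚ`, every `ℓ`-component (`ℓ ≠ p`) equals `q` and the
  `p`-component equals `q` (Milne's "Equivalently"); components are computed in
  `L ⊗ H^{2d}(A₀) → L` (`PreWeilCohomology.lefschetzPairing`).

## Design choices / junk analysis

* A `Prop`-valued DEFINITION with the data as explicit binder, NOT a closed `Prop` quantifying over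
  all data: the axioms do not determine the specialization isomorphism (composing `D.sp ℓ` with the
  automorphism `Λ^•g`, `g ∈ SL(H¹(A₀))`, of `H^•(A₀) = Λ^•H¹` gives data of the same type on which
  the statement fails), so `∀ D, …` would be false rather than open. The conjecture proper is
  `MilneRationalityConjecture D` at the intended `D`; routes carry `D` (and pins such as
  `EtaleRealization.IsProetaleModel`) as for `TateConjecture ℓ E`.
* `SpecializationData`/`MilneRealizationData` are general (any local `R → k`, any `k ⊆ ℂ`); the
  conjecture is pinned to `ℚ^al ⊂ ℂ` as printed (for bigger algebraically closed `k ⊆ ℂ` the residue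
  fields are not algebraic over `𝔽_p`: a different, stronger statement).
* `ℓ`-adic data on the special fibre only for `ℓ ≠ p` (no Weil cohomology with `ℚ_p`-coefficients
  exists on `𝔽̄_p`-varieties, so requiring `D.E₀ p` would exclude the intended data);
  `[PerfectRing 𝔽 p]` (needed by `CrystallineRealization`) is automatic for `k = ℚ^al` (`𝔽` is
  algebraically closed, `isAlgClosed_residueField_ratAlgebraicClosure`).
* No smooth-projectivity hypothesis on `A`, `A ⊗ ℂ`, `A₀` in the statement: only the DATA of the
  theories enters it (their axioms are guarded by such hypotheses). If `A ⊗_ι ℂ` had no Hodge model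
  no class would be of Hodge type; Hodge models exist (tree fact `nonempty_hodgeModel`), exactly as
  for the summit statement `HodgeConjecture`.
* NOT here: weak rationality (Def. 4.2), good theories of rational Tate classes, Thm. 4.3, "HC ⟹
  rationality"; Tate twists (all theories untwisted, `tr (cl pt) = 1`; `⟨γ₀ ∪ δ⟩_l` is invariant).

## References

[Milne2009RationalTate] Mosc. Math. J. 9 (2009) = arXiv:0707.3167: Conventions p. 2; §1.3 p. 7;
§3.1 p. 13; §4.1 p. 18 (Conjecture, Ex. 4.1, Def. 4.2, Thm. 4.3); Rem. 4.5, Aside 4.6 p. 19.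
[Deligne1982HodgeCycles] LNM 900, Prop. 2.9, Thm. 2.11. [DeligneMilne1982] I §1.
[DeligneSGA4half1977] [Arcata] V Thm. 3.1. [BerthelotOgus1983] Thm. 2.4. [SerreTate1968] §1.
-/

noncomputable section

open CategoryTheory AlgebraicGeometry
open scoped TensorProduct Isocrystal
open Literature.AlgebraicTopology.SingularHomology

universe u v w w'

namespace Literature.AlgebraicGeometry.Motives

/-! ### The special fibre of an integral model over a local ring -/

namespace IntegralModel

variable {R K : Type u} [CommRing R] [IsLocalRing R] [Field K] [Algebra R K] {X : SchemeOver K}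
  (𝒳 : IntegralModel R K X)

/-- The **special fibre** `𝒳 ×_R κ` of an integral model `𝒳` over a local ring `R`, over the residue
field `κ = IsLocalRing.ResidueField R` (the type carrying Mathlib's `Field` instance): base change
along `IsLocalRing.residue R` — i.e. `𝒳.reduction (maximalIdeal R)`, formed with `residue` instead
of `algebraMap` (Serre–Tate 1968, §1; cf. `reductionAt`, `WittScheme.specialFibre`).
[cite: SerreTate1968, §1] -/
def specialFibre : SchemeOver (IsLocalRing.ResidueField R) :=
  (baseChangeHom (IsLocalRing.residue R)).obj 𝒳.total

/-- The special fibre of a proper model is proper (base change; Stacks 01W4). [folklore] -/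
instance isProper_specialFibre [IsProper 𝒳.total.hom] : IsProper 𝒳.specialFibre.hom :=
  MorphismProperty.baseChange_obj _ _ ‹_›

/-- The special fibre of a smooth model is smooth, same relative dimension. [folklore] -/
instance smooth_specialFibre (n : ℕ) [SmoothOfRelativeDimension n 𝒳.total.hom] :
    SmoothOfRelativeDimension n 𝒳.specialFibre.hom :=
  haveI := smoothOfRelativeDimension_isStableUnderBaseChange (n := n)
  MorphismProperty.baseChange_obj _ _ ‹_›

/-- The special fibre of a smooth proper model is smooth (same relative dimension) and proper
("good reduction", Serre–Tate 1968, §1). [cite: SerreTate1968, §1] -/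
theorem IsSmoothProper.specialFibre {n : ℕ} (h : 𝒳.IsSmoothProper n) :
    SmoothOfRelativeDimension n 𝒳.specialFibre.hom ∧ IsProper 𝒳.specialFibre.hom :=
  haveI := h.1; haveI := h.2; ⟨inferInstance, inferInstance⟩

end IntegralModel

/-! ### Lefschetz monomials and the pairing `⟨x ∪ δ⟩` -/

namespace PreWeilCohomology

variable {k : Type u} [Field k] {K : Type v} [Field K] (W : PreWeilCohomology k K)
  (X : SchemeOver k)

/-- The **Lefschetz monomial** `cl(D₀) ∪ ⋯ ∪ cl(D_{s-1}) ∈ H²ˢ(X)` of a tuple `D : Fin s → X` of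
points (meaningful for prime divisors, `codim Dᵢ = 1`; the empty monomial is `1 ∈ H⁰(X)`). Milne's
Lefschetz classes of codimension `s` are the `ℚ`-linear combinations of these monomials (the
`ℚ`-subalgebra of `H^{2*}(X)(*)` generated by divisor classes).
[cite: Milne2009RationalTate, §1.3] -/
def divisorMonomial : (s : ℕ) → (Fin s → X.left) → W.obj X (2 * s)
  | 0, _ => W.one X
  | s + 1, D =>
    W.cup (by omega) (divisorMonomial s (Fin.init D)) (W.cycleClass X 1 (D (Fin.last s)))

/-- The empty Lefschetz monomial is the unit `1 ∈ H⁰(X)`. [folklore] -/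
@[simp]
theorem divisorMonomial_zero (D : Fin 0 → X.left) : W.divisorMonomial X 0 D = W.one X := rfl

variable (L : Type w') [Field L] [Algebra K L]

/-- The **Lefschetz pairing** `⟨x ∪ cl(D₀) ∪ ⋯ ∪ cl(D_{s-1})⟩ ∈ L` of a class `x ∈ L ⊗_K H²ʳ(X)`
(coefficients extended to an overfield `L ⊇ K`, as in `H_p(A₀) ⊗_{B(𝔽)} ℚ^al_w`) with a Lefschetz
monomial of complementary codimension, `r + s = d = dim X`: the `L`-linear extension of the trace
`H²ᵈ(X) → K` applied to the `L`-bilinear cup product `x ∪ (1 ⊗ δ_D)` (Milne 2009, §4.1: "the cup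
product … with a Lefschetz class of complementary dimension").
[cite: Milne2009RationalTate, §4.1] -/
def lefschetzPairing {r s d : ℕ} (h : r + s = d) (x : L ⊗[K] W.obj X (2 * r))
    (D : Fin s → X.left) : L :=
  Module.Dual.baseChange L (W.trace X d)
    (W.cupBaseChange L (show 2 * r + 2 * s = 2 * d by omega) x (1 ⊗ₜ W.divisorMonomial X s D))

end PreWeilCohomology

/-! ### Specialization data (cospecialisation / Berthelot–Ogus isomorphisms as hypotheses) -/

/-- **Specialization data** from a (pre-)Weil cohomology theory `W` on `k`-schemes (coefficients
`K`) to a theory `W₀` on schemes over the residue field `κ` of a local ring `R → k` (coefficients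
`K₀`), over a common overfield `L ⊇ K, K₀`: for every integral model `𝒳` over `R` of a `k`-scheme
`X`, `L`-linear maps `L ⊗_K Hⁱ(X) ⇄ L ⊗_{K₀} H₀ⁱ(𝒳 ×_R κ)` which, for `X` smooth projective and `𝒳`
smooth proper, are mutually inverse and compatible with units, cup products and traces (fields
shaped like `WeilComparison`; nothing on cycle classes or pull-backs). A HYPOTHESIS STRUCTURE;
intended values: (i) cospecialisation `H(X_{k̄}, ℚ_ℓ) ≃ H(𝒳_{κ̄}, ℚ_ℓ)`, `ℓ` invertible on `R`
(smooth and proper base change, SGA 4½ [Arcata] V Thm. 3.1; Milne 2009 §3.1, "the specialization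
map"); (ii) Berthelot–Ogus `H_dR(X_K/K) ≃ H_crys(X₀/W) ⊗_W K`, `𝒳` smooth proper over a complete
d.v.r. (1983, Thm. 2.4). [cite: DeligneSGA4half1977, Arcata V Thm. 3.1]
[cite: BerthelotOgus1983, Thm. 2.4] [cite: Milne2009RationalTate, §3.1] -/
structure SpecializationData {k : Type u} [Field k] (R : Type u) [CommRing R] [IsLocalRing R]
    [Algebra R k] {K : Type v} {K₀ : Type w} [Field K] [Field K₀] (W : PreWeilCohomology k K)
    (W₀ : PreWeilCohomology (IsLocalRing.ResidueField R) K₀) (L : Type w') [Field L] [Algebra K L]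
    [Algebra K₀ L] where
  /-- The specialization map `L ⊗_K Hⁱ(X) →ₗ[L] L ⊗_{K₀} H₀ⁱ(𝒳 ×_R κ)` of a model `𝒳`.
  [cite: Milne2009RationalTate, §3.1] -/
  iso {X : SchemeOver k} (𝒳 : IntegralModel R k X) (i : ℕ) :
    L ⊗[K] W.obj X i →ₗ[L] L ⊗[K₀] W₀.obj 𝒳.specialFibre i
  /-- The inverse specialization map. [cite: Milne2009RationalTate, §3.1] -/
  isoInv {X : SchemeOver k} (𝒳 : IntegralModel R k X) (i : ℕ) :
    L ⊗[K₀] W₀.obj 𝒳.specialFibre i →ₗ[L] L ⊗[K] W.obj X i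
  /-- `isoInv ∘ iso = id` for a smooth proper model of a smooth projective `X`.
  [cite: DeligneSGA4half1977, Arcata V Thm. 3.1] -/
  isoInv_iso : ∀ ⦃n : ℕ⦄ ⦃X : SchemeOver k⦄, IsSmoothProjective n X →
    ∀ (𝒳 : IntegralModel R k X), 𝒳.IsSmoothProper n →
      ∀ (i : ℕ) (x : L ⊗[K] W.obj X i), isoInv 𝒳 i (iso 𝒳 i x) = x
  /-- `iso ∘ isoInv = id` for a smooth proper model of a smooth projective `X`.
  [cite: DeligneSGA4half1977, Arcata V Thm. 3.1] -/
  iso_isoInv : ∀ ⦃n : ℕ⦄ ⦃X : SchemeOver k⦄, IsSmoothProjective n X →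
    ∀ (𝒳 : IntegralModel R k X), 𝒳.IsSmoothProper n →
      ∀ (i : ℕ) (y : L ⊗[K₀] W₀.obj 𝒳.specialFibre i), iso 𝒳 i (isoInv 𝒳 i y) = y
  /-- Specialization preserves units: `iso (1 ⊗ 1) = 1 ⊗ 1`.
  [cite: DeligneSGA4half1977, Arcata V Thm. 3.1] -/
  iso_one : ∀ ⦃n : ℕ⦄ ⦃X : SchemeOver k⦄, IsSmoothProjective n X →
    ∀ (𝒳 : IntegralModel R k X), 𝒳.IsSmoothProper n →
      iso 𝒳 0 (1 ⊗ₜ W.one X) = 1 ⊗ₜ W₀.one 𝒳.specialFibre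
  /-- Specialization is multiplicative for the (`L`-bilinearly extended) cup products.
  [cite: DeligneSGA4half1977, Arcata V Thm. 3.1] -/
  iso_cup : ∀ ⦃n : ℕ⦄ ⦃X : SchemeOver k⦄, IsSmoothProjective n X →
    ∀ (𝒳 : IntegralModel R k X), 𝒳.IsSmoothProper n →
      ∀ ⦃i j m : ℕ⦄ (h : i + j = m) (x : L ⊗[K] W.obj X i) (y : L ⊗[K] W.obj X j),
        iso 𝒳 m (W.cupBaseChange L h x y) = W₀.cupBaseChange L h (iso 𝒳 i x) (iso 𝒳 j y)
  /-- Specialization is compatible with the traces `H²ⁿ → coefficients` (`n = dim`, both normalised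
  by `tr (cl pt) = 1`): `tr₀ ∘ iso = tr` on `L ⊗ H²ⁿ(X)`.
  [cite: DeligneSGA4half1977, Arcata V Thm. 3.1] -/
  iso_trace : ∀ ⦃n : ℕ⦄ ⦃X : SchemeOver k⦄, IsSmoothProjective n X →
    ∀ (𝒳 : IntegralModel R k X), 𝒳.IsSmoothProper n →
      ∀ x : L ⊗[K] W.obj X (2 * n),
        Module.Dual.baseChange L (W₀.trace 𝒳.specialFibre n) (iso 𝒳 (2 * n) x) =
          Module.Dual.baseChange L (W.trace X n) x

namespace SpecializationData

variable {k : Type u} [Field k] {R : Type u} [CommRing R] [IsLocalRing R] [Algebra R k]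
  {K : Type v} {K₀ : Type w} [Field K] [Field K₀] {W : PreWeilCohomology k K}
  {W₀ : PreWeilCohomology (IsLocalRing.ResidueField R) K₀} {L : Type w'} [Field L] [Algebra K L]
  [Algebra K₀ L] (S : SpecializationData R W W₀ L)

/-- For a smooth proper model `𝒳` of a smooth projective `X` the specialization map is an
`L`-linear equivalence `L ⊗_K Hⁱ(X) ≃ₗ[L] L ⊗_{K₀} H₀ⁱ(𝒳 ×_R κ)`.
[cite: DeligneSGA4half1977, Arcata V Thm. 3.1] -/
def isoEquiv {n : ℕ} {X : SchemeOver k} (hX : IsSmoothProjective n X) (𝒳 : IntegralModel R k X)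
    (h𝒳 : 𝒳.IsSmoothProper n) (i : ℕ) :
    L ⊗[K] W.obj X i ≃ₗ[L] L ⊗[K₀] W₀.obj 𝒳.specialFibre i :=
  LinearEquiv.ofLinear (S.iso 𝒳 i) (S.isoInv 𝒳 i) (LinearMap.ext (S.iso_isoInv hX 𝒳 h𝒳 i))
    (LinearMap.ext (S.isoInv_iso hX 𝒳 h𝒳 i))

end SpecializationData

/-! ### Milne's adelic realization data at a `p`-adic prime -/

/-- **Milne's realization data** at a `p`-adic prime `O` of a subfield `k ⊆ ℂ` (Milne 2009, §3.1;
"`p`-adic": the residue field `𝔽 = IsLocalRing.ResidueField O` has characteristic `p`, instance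
argument `[CharP 𝔽 p]`; `[PerfectRing 𝔽 p]` is what `CrystallineRealization` requires, automatic for
`k = ℚ^al`): the hypothesis structures needed to form `H_𝔸(X)`, `H_𝔸(X₀)` and the specialization map
for `k`-varieties with good reduction at `O` — de Rham cohomology with its comparison to Betti
cohomology (`P`), ℓ-adic cohomology of `k`-varieties with Artin's comparison (`E`, `artin`), ℓ-adic
(`ℓ ≠ p`) and crystalline cohomology of `𝔽`-varieties (`E₀`, `crys`), a field `L` over `k` and over
`B(𝔽) = K(p, 𝔽)` (intended: `ℚ^al_w`), and the specialization data `sp`, `spCrys` (the latter valued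
in `L ⊗_{B(𝔽)} H_p(X₀)`). Intended values: module docstring. [cite: Milne2009RationalTate, §3.1] -/
structure MilneRealizationData (k : Subfield ℂ) (p : ℕ) [Fact p.Prime] (O : ValuationSubring k)
    [CharP (IsLocalRing.ResidueField O) p] [PerfectRing (IsLocalRing.ResidueField O) p] where
  /-- Algebraic de Rham cohomology of `k`-varieties, Betti–Hodge data of `ℂ`-varieties and the
  (twisted) de Rham–Betti comparison along every `σ : k →+* ℂ`.
  [cite: Deligne1982HodgeCycles, §1] -/
  P : PeriodRealization k
  /-- ℓ-adic cohomology `H•((–) ⊗_k k̄, ℚ_ℓ)` of `k`-varieties.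
  [cite: Milne2009RationalTate, §3.1] -/
  E (ℓ : ℕ) [Fact ℓ.Prime] : EtaleRealization k ℓ
  /-- Artin's comparison `ℚ_ℓ ⊗ H_B((–) ⊗_k ℂ, ℚ) ≃ H_ℓ` along `k ⊆ ℂ`.
  [cite: DeligneMilne1982, I §1] -/
  artin (ℓ : ℕ) [Fact ℓ.Prime] : ArtinComparison (E ℓ) P.B k.subtype
  /-- ℓ-adic cohomology of `𝔽`-varieties, `ℓ ≠ p`. [cite: Milne2009RationalTate, §3.1] -/
  E₀ (ℓ : ℕ) [Fact ℓ.Prime] : ℓ ≠ p → EtaleRealization (IsLocalRing.ResidueField O) ℓ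
  /-- The ℓ-adic specialization maps `H_ℓ(X) ≃ H_ℓ(𝒳 ×_O 𝔽)` (smooth and proper base change).
  [cite: DeligneSGA4half1977, Arcata V Thm. 3.1] -/
  sp (ℓ : ℕ) [Fact ℓ.Prime] (hℓ : ℓ ≠ p) :
    SpecializationData O (E ℓ).toPreWeilCohomology (E₀ ℓ hℓ).toPreWeilCohomology ℚ_[ℓ]
  /-- Crystalline cohomology of `𝔽`-varieties (the tree's `CrystallineRealization`, coefficients
  `B(𝔽) = K(p, 𝔽)`). [cite: Milne2009RationalTate, §3.1] -/
  crys : CrystallineRealization p (IsLocalRing.ResidueField O)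
  /-- The `p`-adic coefficient field (intended: the completion `ℚ^al_w ⊇ B(𝔽)` of `k` at `w`).
  [cite: Milne2009RationalTate, §3.1] -/
  L : Type
  /-- `L` is a field … [cite: Milne2009RationalTate, §3.1] -/
  [instField : Field L]
  /-- … over `k` (`k → k_w`) … [cite: Milne2009RationalTate, §3.1] -/
  [instAlgebra : Algebra k L]
  /-- … and over `B(𝔽) = W(𝔽)[1/p]`. [cite: Milne2009RationalTate, §3.1] -/
  [instAlgebraWitt : Algebra K(p, IsLocalRing.ResidueField O) L]
  /-- The `p`-adic specialization maps `L ⊗_k H_dR(X) ≃ L ⊗_{B(𝔽)} H_p(𝒳 ×_O 𝔽)` (Berthelot–Ogus).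
  [cite: BerthelotOgus1983, Thm. 2.4] -/
  spCrys : SpecializationData O P.dR.toPreWeilCohomology crys.toPreWeilCohomology L

namespace MilneRealizationData

attribute [instance] instField instAlgebra instAlgebraWitt

variable {k : Subfield ℂ} {p : ℕ} [Fact p.Prime] {O : ValuationSubring k}
  [CharP (IsLocalRing.ResidueField O) p] [PerfectRing (IsLocalRing.ResidueField O) p]
  (D : MilneRealizationData k p O)

/-- The **`ℓ`-component of the specialization** of a Betti class `t ∈ Hⁱ_B(X ⊗_k ℂ, ℚ)` along a
model `𝒳` of `X` over `O`: Artin's comparison `ℚ_ℓ ⊗ Hⁱ_B → ℚ_ℓ ⊗ Hⁱ_ℓ(X)` followed by the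
specialization map to `ℚ_ℓ ⊗ Hⁱ_ℓ(𝒳 ×_O 𝔽)` (Milne 2009, §3.1, "`γ₀`").
[cite: Milne2009RationalTate, §3.1] -/
def specializeBetti (ℓ : ℕ) [Fact ℓ.Prime] (hℓ : ℓ ≠ p) {X : SchemeOver k}
    (𝒳 : IntegralModel O k X) (i : ℕ) (t : D.P.B.W.obj ((baseChangeHom k.subtype).obj X) i) :
    ℚ_[ℓ] ⊗[ℚ_[ℓ]] (D.E₀ ℓ hℓ).obj 𝒳.specialFibre i :=
  (D.sp ℓ hℓ).iso 𝒳 i ((D.artin ℓ).isoInv X i ((1 : ℚ_[ℓ]) ⊗ₜ[ℚ] t))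

/-- The **`p`-component of the specialization** of a de Rham class `α ∈ Hⁱ_dR(X/k)` along `𝒳`: the
image of `1 ⊗ α` under the `p`-adic specialization map `L ⊗_k Hⁱ_dR(X) → L ⊗_{B(𝔽)} Hⁱ_p(𝒳 ×_O 𝔽)`
(Milne 2009, §3.1). [cite: Milne2009RationalTate, §3.1] -/
def specializeDeRham {X : SchemeOver k} (𝒳 : IntegralModel O k X) (i : ℕ) (α : D.P.dR.obj X i) :
    D.L ⊗[K(p, IsLocalRing.ResidueField O)] D.crys.obj 𝒳.specialFibre i :=
  D.spCrys.iso 𝒳 i ((1 : D.L) ⊗ₜ[k] α)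

end MilneRealizationData

/-! ### The rationality conjecture -/

/-- `ℚ^al ⊂ ℂ`: the algebraic closure of `ℚ` in `ℂ` as a subfield (Milne 2009, §3.1). -/
local notation "ℚal" => IntermediateField.toSubfield (algebraicClosure ℚ ℂ)

/-- `ℚ^al ⊂ ℂ` is algebraically closed (Mathlib `algebraicClosure.isAlgClosure`, restated for the
subfield type, where instance search does not find it). [folklore] -/
instance isAlgClosed_ratAlgebraicClosure : IsAlgClosed ℚal :=
  (algebraicClosure.isAlgClosure ℚ ℂ).isAlgClosed

/-- The residue field `𝔽` of a prime of `ℚ^al` is algebraically closed (Milne 2009, §3.1; the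
tree's `isAlgClosed_residueField_of_isAlgClosed`), hence perfect — this supplies the instance
`PerfectRing 𝔽 p` that `MilneRealizationData` needs. [cite: Milne2009RationalTate, §3.1] -/
instance isAlgClosed_residueField_ratAlgebraicClosure (O : ValuationSubring ℚal) :
    IsAlgClosed (IsLocalRing.ResidueField O) :=
  Resolution.isAlgClosed_residueField_of_isAlgClosed O

/-- **Milne's Rationality Conjecture** (Milne, *Rational Tate classes*, Mosc. Math. J. 9 (2009),
§4.1): *Let `A` be an abelian variety over `ℚ^al` with good reduction to an abelian variety `A₀`
over `𝔽`. The cup product of the specialization to `A₀` of any Hodge class on `A` with any Lefschetz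
class of complementary dimension lies in `ℚ ⊂ 𝔸^p_f × ℚ^al_w`. Equivalently, the `l`-component of
`γ₀ ∪ δ` is a rational number independent of `l`* (`l = p` allowed). Relative to Milne realization
data `D` at the `p`-adic prime `O` of `ℚ^al = (algebraicClosure ℚ ℂ).toSubfield` (explicit binder;
module docstring: rendering, and why a predicate on `D`): for every abelian variety `A/ℚ^al`, every
smooth proper model `𝒜` of `A` over `O` (`A₀ = 𝒜 ×_O 𝔽`), all `r + s = dim A`, every rational Betti
class `t ∈ H^{2r}(A(ℂ); ℚ)` (cocycle witness `ζ`) whose complexification is of Hodge type `(r, r)`,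
and every Lefschetz monomial `δ = cl(D₁) ∪ ⋯ ∪ cl(D_s)` in prime divisors `Dᵢ` of `A₀`, there is ONE
`q ∈ ℚ` with `⟨γ₀,ℓ ∪ δ⟩ = q` in `ℚ_ℓ` for every prime `ℓ ≠ p` and `⟨γ₀,p ∪ δ⟩ = q` in `L ⊇ ℚ^al_w`
for every de Rham representative `α` of `t` (`iso (1 ⊗ α) = (2πi)^r (1 ⊗ t)`). Implied by the Hodge
conjecture for abelian varieties; known for `A` CM with `A₀` simple ordinary (Ex. 4.1); open.
[cite: Milne2009RationalTate, §4.1] -/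
def MilneRationalityConjecture {p : ℕ} [Fact p.Prime] {O : ValuationSubring ℚal}
    [CharP (IsLocalRing.ResidueField O) p] (D : MilneRealizationData ℚal p O) : Prop :=
  ∀ (A : AbelianVariety ℚal) (𝒜 : IntegralModel O ℚal A.X), 𝒜.IsSmoothProper A.dim →
  ∀ ⦃r s : ℕ⦄ (hrs : r + s = A.dim)
    (t : D.P.B.W.obj ((baseChangeHom (Subfield.subtype ℚal)).obj A.X) (2 * r))
    (ζ : singularCochainComplex.cocycles ℚ ℚ
      (ComplexPoints ((baseChangeHom (Subfield.subtype ℚal)).obj A.X)) (2 * r)),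
    singularCohomology.π ℚ ℚ _ (2 * r) ζ = D.P.B.isoObj _ (2 * r) t →
    HodgeTheory.IsOfHodgeType A.dim ((baseChangeHom (Subfield.subtype ℚal)).obj A.X) (2 * r) r r
      (singularCohomology.π ℂ ℂ _ (2 * r) (HodgeTheory.cocycleOfRat _ (2 * r) ζ)) →
  ∀ (Dv : Fin s → 𝒜.specialFibre.left), (∀ i, Order.coheight (Dv i) = (1 : ℕ)) →
  ∃ q : ℚ,
    (∀ (ℓ : ℕ) [Fact ℓ.Prime] (hℓ : ℓ ≠ p),
      (D.E₀ ℓ hℓ).lefschetzPairing 𝒜.specialFibre ℚ_[ℓ] hrs (D.specializeBetti ℓ hℓ 𝒜 (2 * r) t)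
        Dv = (q : ℚ_[ℓ])) ∧
    (∀ α : D.P.dR.obj A.X (2 * r),
      D.P.iso (Subfield.subtype ℚal) A.X (2 * r) (1 ⊗ₜ α) =
        twoPiI (Subfield.subtype ℚal) ^ r • ((1 : AlongHom ℂ (Subfield.subtype ℚal)) ⊗ₜ[ℚ] t) →
      D.crys.lefschetzPairing 𝒜.specialFibre D.L hrs (D.specializeDeRham 𝒜 (2 * r) α) Dv =
        (q : D.L))

/-! ### Sanity: the conjecture in top codimension (`r = dim A`, empty Lefschetz monomial) -/

section Sanity

variable {k : Type u} [Field k] {K : Type v} [Field K] [CharZero K] (W : WeilCohomology k K)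
  (L : Type w') [Field L] [Algebra K L]

/-- `x ∪ 1 = x` on a smooth projective `X` (graded commutativity and `1 ∪ x = x`; the degree of `1`
is spelled `2 * 0`, as in `divisorMonomial _ 0`). [folklore] -/
theorem WeilCohomology.cup_one_right {n : ℕ} {X : SchemeOver k} (hX : IsSmoothProjective n X)
    {i : ℕ} (h : i + 2 * 0 = i) (x : W.obj X i) : W.cup h x (W.one X) = x := by
  rw [W.cup_comm hX h (by omega : 2 * 0 + i = i) x (W.one X)]
  have e : W.cup (by omega : 2 * 0 + i = i) (W.one X) x = x := W.one_cup hX (Nat.zero_add i) x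
  rw [e]
  simp

/-- `z ∪ (1 ⊗ 1) = z` for the `L`-bilinear cup product on `L ⊗ Hⁱ(X)`. [folklore] -/
theorem WeilCohomology.cupBaseChange_one_right {n : ℕ} {X : SchemeOver k}
    (hX : IsSmoothProjective n X) {i : ℕ} (h : i + 2 * 0 = i) (z : L ⊗[K] W.obj X i) :
    W.cupBaseChange L h z ((1 : L) ⊗ₜ[K] W.one X) = z := by
  induction z using TensorProduct.induction_on with
  | zero => simp
  | tmul a x =>
    rw [PreWeilCohomology.cupBaseChange_tmul, mul_one, W.cup_one_right hX h x]
  | add z₁ z₂ h₁ h₂ => rw [map_add, LinearMap.add_apply, h₁, h₂]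

end Sanity

namespace MilneRealizationData

variable {k : Subfield ℂ} {p : ℕ} [Fact p.Prime] {O : ValuationSubring k}
  [CharP (IsLocalRing.ResidueField O) p] [PerfectRing (IsLocalRing.ResidueField O) p]
  (D : MilneRealizationData k p O)

/-- **The `ℓ`-component in top codimension.** For `X/k` smooth projective of dimension `n` with a
smooth proper model `𝒳` over `O` whose special fibre is smooth projective, and any rational Betti
class `t ∈ H²ⁿ_B(X ⊗_k ℂ)`, the pairing of the specialization `γ₀,ℓ` of `t` with the EMPTY Lefschetz
monomial is `tr_B(t) ∈ ℚ`, for every `ℓ ≠ p` (from `iso_trace` of the specialization data and of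
Artin's comparison). [folklore] -/
theorem lefschetzPairing_specializeBetti_fin_zero (ℓ : ℕ) [Fact ℓ.Prime] (hℓ : ℓ ≠ p) {n : ℕ}
    {X : SchemeOver k} (hX : IsSmoothProjective n X) (𝒳 : IntegralModel O k X)
    (h𝒳 : 𝒳.IsSmoothProper n) (hX₀ : IsSmoothProjective n 𝒳.specialFibre)
    (t : D.P.B.W.obj ((baseChangeHom k.subtype).obj X) (2 * n))
    (Dv : Fin 0 → 𝒳.specialFibre.left) (h : n + 0 = n) :
    (D.E₀ ℓ hℓ).lefschetzPairing 𝒳.specialFibre ℚ_[ℓ] h (D.specializeBetti ℓ hℓ 𝒳 (2 * n) t) Dv =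
      (D.P.B.W.trace ((baseChangeHom k.subtype).obj X) n t : ℚ_[ℓ]) := by
  simp only [PreWeilCohomology.lefschetzPairing, PreWeilCohomology.divisorMonomial_zero]
  rw [(D.E₀ ℓ hℓ).cupBaseChange_one_right ℚ_[ℓ] hX₀, specializeBetti,
    (D.sp ℓ hℓ).iso_trace hX 𝒳 h𝒳, ← (D.artin ℓ).iso_trace hX, (D.artin ℓ).iso_isoInv hX,
    Module.Dual.baseChange_apply_tmul, Algebra.smul_def, mul_one, eq_ratCast]
  rfl

/-- **The `p`-component in top codimension.** In the situation of
`lefschetzPairing_specializeBetti_fin_zero`, for every de Rham class `α ∈ H²ⁿ_dR(X/k)` comparing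
to `t` along `k ⊆ ℂ` (`iso (1 ⊗ α) = (2πi)ⁿ (1 ⊗ t)`), the pairing of the crystalline specialization
of `α` with the empty Lefschetz monomial is the SAME rational number `tr_B(t)`: the twists `(2πi)ⁿ`
of `PeriodRealization.iso_trace` and of the comparison hypothesis cancel. [folklore] -/
theorem lefschetzPairing_specializeDeRham_fin_zero {n : ℕ} {X : SchemeOver k}
    (hX : IsSmoothProjective n X) (𝒳 : IntegralModel O k X) (h𝒳 : 𝒳.IsSmoothProper n)
    (hX₀ : IsSmoothProjective n 𝒳.specialFibre)
    (t : D.P.B.W.obj ((baseChangeHom k.subtype).obj X) (2 * n)) (α : D.P.dR.obj X (2 * n))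
    (hα : D.P.iso k.subtype X (2 * n) (1 ⊗ₜ α) =
      twoPiI k.subtype ^ n • ((1 : AlongHom ℂ k.subtype) ⊗ₜ[ℚ] t))
    (Dv : Fin 0 → 𝒳.specialFibre.left) (h : n + 0 = n) :
    D.crys.lefschetzPairing 𝒳.specialFibre D.L h (D.specializeDeRham 𝒳 (2 * n) α) Dv =
      (D.P.B.W.trace ((baseChangeHom k.subtype).obj X) n t : D.L) := by
  -- the de Rham trace of `α` is the Betti trace of `t` (the twists `(2πi)ⁿ` cancel)
  have key : D.P.dR.trace X n α = ((D.P.B.comap k.subtype).trace X n t : k) := by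
    let A := AlongHom ℂ k.subtype
    let f := Module.Dual.baseChange A ((D.P.B.comap k.subtype).trace X n)
    let v : A ⊗[ℚ] (D.P.B.comap k.subtype).obj X (2 * n) := (1 : A) ⊗ₜ[ℚ] t
    have h1 := D.P.iso_trace k.subtype hX ((1 : A) ⊗ₜ α)
    have e1 : D.P.iso k.subtype X (2 * n) ((1 : A) ⊗ₜ α) = twoPiI k.subtype ^ n • v := hα
    have e2 : f (twoPiI k.subtype ^ n • v) = twoPiI k.subtype ^ n • f v := map_smul f _ v
    have e3 : f v = (D.P.B.comap k.subtype).trace X n t • (1 : A) :=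
      Module.Dual.baseChange_apply_tmul _ _ _ _
    have e4 : Module.Dual.baseChange A (D.P.dR.trace X n) ((1 : A) ⊗ₜ α) =
        D.P.dR.trace X n α • (1 : A) := Module.Dual.baseChange_apply_tmul _ _ _ _
    have h2 : twoPiI k.subtype ^ n • ((D.P.B.comap k.subtype).trace X n t • (1 : A)) =
        twoPiI k.subtype ^ n • (D.P.dR.trace X n α • (1 : A)) := by
      rw [← e3, ← e2, ← e1, ← e4]
      exact h1
    have h3 := smul_right_injective A (pow_ne_zero n (isUnit_twoPiI k.subtype).ne_zero) h2
    rw [Algebra.smul_def, Algebra.smul_def, mul_one, mul_one, eq_ratCast] at h3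
    apply (algebraMap k A).injective
    rw [← h3, map_ratCast]
  simp only [PreWeilCohomology.lefschetzPairing, PreWeilCohomology.divisorMonomial_zero]
  rw [D.crys.cupBaseChange_one_right D.L hX₀, specializeDeRham, D.spCrys.iso_trace hX 𝒳 h𝒳,
    Module.Dual.baseChange_apply_tmul, Algebra.smul_def, mul_one]
  change algebraMap k D.L (D.P.dR.trace X n α) = _
  rw [key, map_ratCast]
  rfl

/-- **Milne's rationality statement holds in top codimension** (`r = dim`, `s = 0`: the only
Lefschetz monomial is `1`), for ANY realization data and any rational Betti class `t` (no Hodge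
condition needed): the common rational value is `tr_B(t)`. For `k = ℚ^al` this is the case
`r = dim A` of `MilneRationalityConjecture D` (given smooth projectivity of `A` and `A₀`, which the
axioms of the hypothesis structures require). A consistency check of the twist conventions.
[cite: Milne2009RationalTate, §4.1] -/
theorem exists_rat_lefschetzPairing_fin_zero {n : ℕ} {X : SchemeOver k}
    (hX : IsSmoothProjective n X) (𝒳 : IntegralModel O k X) (h𝒳 : 𝒳.IsSmoothProper n)
    (hX₀ : IsSmoothProjective n 𝒳.specialFibre) (h : n + 0 = n)
    (t : D.P.B.W.obj ((baseChangeHom k.subtype).obj X) (2 * n))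
    (Dv : Fin 0 → 𝒳.specialFibre.left) :
    ∃ q : ℚ,
      (∀ (ℓ : ℕ) [Fact ℓ.Prime] (hℓ : ℓ ≠ p),
        (D.E₀ ℓ hℓ).lefschetzPairing 𝒳.specialFibre ℚ_[ℓ] h (D.specializeBetti ℓ hℓ 𝒳 (2 * n) t)
          Dv = (q : ℚ_[ℓ])) ∧
      (∀ α : D.P.dR.obj X (2 * n),
        D.P.iso k.subtype X (2 * n) (1 ⊗ₜ α) =
          twoPiI k.subtype ^ n • ((1 : AlongHom ℂ k.subtype) ⊗ₜ[ℚ] t) →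
        D.crys.lefschetzPairing 𝒳.specialFibre D.L h (D.specializeDeRham 𝒳 (2 * n) α) Dv =
          (q : D.L)) :=
  ⟨D.P.B.W.trace ((baseChangeHom k.subtype).obj X) n t,
    fun ℓ _ hℓ ↦ D.lefschetzPairing_specializeBetti_fin_zero ℓ hℓ hX 𝒳 h𝒳 hX₀ t Dv h,
    fun α hα ↦ D.lefschetzPairing_specializeDeRham_fin_zero hX 𝒳 h𝒳 hX₀ t α hα Dv h⟩

end MilneRealizationData

end Literature.AlgebraicGeometry.Motives

end
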